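import Mathlib
import HarnessLib
import Summits.PneNP.PneNP.Theorems.CnfIdealGenLengthRankStability

/-!
# Crux `RankDefectRepresentations` (stmt-PneNP-18923), line `phantom-kernel`: the PHANTOM CEILING (negative tool)

The line's own ceiling theorem (lead prover, 2026-08-27), the phantom analogue of the route's rank counting
`rank_clauseProduct_le_of_hasBoundedRepr`: if the constant `1` has a LEFT-IDEAL-PLUS-AXIOMS certificate over the
clause words of `φ` — an identity `Σ_p a_p · Q_{κ_p} + Σ_{ρ<r} u_ρ · g_ρ · v_ρ = 1` in the free algebra with
`κ_p ∈ φ`, `g_ρ` Boolean/commutator axioms and ARBITRARY cofactors — then at every matrix tuple `M` whose axioms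
have rank `≤ t`, every subspace `U` killed by the clause words of `φ` has `dim U ≤ r · t`
(`finrank_phantom_le_of_leftCertificate`): apply the identity to `u ∈ U`; the clause-word terms vanish and `u` lies
in the range of `Σ_ρ u_ρ(M) g_ρ(M) v_ρ(M)`, of rank `≤ r · t`.  So the hard stub S1 (`stub_contradictoryPhantoms`)
needs read-off theories whose LEFT generation length of `1` (left multiples of clause words free, axioms counted) is
superpolynomial — the "commutator area" `λ_C` of `Cruxes/RankDefectRepresentations/TRIAGE-r1-2.md`, kernel-checked as
a bound.  Any explicit certificate family for a theory family kills its phantoms.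
HONEST FRAMING: elementary; P ≠ NP is not moved; F-N2 is a FRONTIER formal rung.
-/

set_option linter.dupNamespace false -- `Summit.PneNP.PneNP.…`: summit = sub-problem name (D-0017)

namespace Summit.PneNP.PneNP.Theorems.CnfIdealGenLength

open Filter
open Literature.Computability.Complexity
open Literature.Computability.MetaComplexity
open Literature.Computability.MetaComplexity.NCIPS

section Ceiling

variable {K : Type} [Field K] {n d : ℕ}

/-- Rank is subadditive over finite sums. [folklore] -/
theorem rank_sum_le {ι : Type} (s : Finset ι) (A : ι → Matrix (Fin d) (Fin d) K) :
    (∑ i ∈ s, A i).rank ≤ ∑ i ∈ s, (A i).rank := by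
  classical
  induction s using Finset.induction_on with
  | empty => simp
  | insert i s hi ih =>
    rw [Finset.sum_insert hi, Finset.sum_insert hi]
    exact (Literature.Computability.AlgebraicComplexity.rank_add_le _ _).trans (Nat.add_le_add_left ih _)

/-- **Phantom ceiling.** A left-ideal-plus-axioms certificate of `1` over the clause words of `φ` with `r` axiom terms
bounds every phantom of `φ`: `dim U ≤ r · t` at every tuple whose axioms have rank `≤ t`. [folklore] -/
theorem finrank_phantom_le_of_leftCertificate (M : Fin n → Matrix (Fin d) (Fin d) K) (t : ℕ)
    (hax : ∀ g : MonoidAlgebra K (FreeMonoid (Fin n)), IsAxiom g →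
      (MonoidAlgebra.lift K (Matrix (Fin d) (Fin d) K) (FreeMonoid (Fin n)) (FreeMonoid.lift M) g).rank ≤ t)
    (φ : CNF (Fin n)) (L : List (MonoidAlgebra K (FreeMonoid (Fin n)) × Clause (Fin n))) (hL : ∀ p ∈ L, p.2 ∈ φ)
    {r : ℕ} (u g v : Fin r → MonoidAlgebra K (FreeMonoid (Fin n))) (hg : ∀ ρ, IsAxiom (g ρ))
    (hcert : (L.map fun p => p.1 * clauseWord K p.2).sum + ∑ ρ, u ρ * g ρ * v ρ = 1)
    (U : Submodule K (Fin d → K))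
    (hU : ∀ κ ∈ φ, ∀ x ∈ U, (MonoidAlgebra.lift K (Matrix (Fin d) (Fin d) K) (FreeMonoid (Fin n))
      (FreeMonoid.lift M) (clauseWord K κ)).mulVec x = 0) :
    Module.finrank K U ≤ r * t := by
  classical
  set ev := MonoidAlgebra.lift K (Matrix (Fin d) (Fin d) K) (FreeMonoid (Fin n)) (FreeMonoid.lift M) with hev
  -- the axiom part of the certificate, evaluated
  set S : Matrix (Fin d) (Fin d) K := ∑ ρ, ev (u ρ * g ρ * v ρ) with hS
  -- `S x = x` on `U`
  have hfix : ∀ x ∈ U, S.mulVec x = x := by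
    intro x hx
    have hzero : ∀ L' : List (MonoidAlgebra K (FreeMonoid (Fin n)) × Clause (Fin n)), (∀ p ∈ L', p.2 ∈ φ) →
        ((L'.map fun p => p.1 * clauseWord K p.2).map ev).sum.mulVec x = 0 := by
      intro L' hL'
      induction L' with
      | nil => simp
      | cons p L' ih =>
        rw [List.map_cons, List.map_cons, List.sum_cons, Matrix.add_mulVec,
          ih (fun q hq => hL' q (List.mem_cons_of_mem _ hq)), add_zero, map_mul, ← Matrix.mulVec_mulVec,
          hU p.2 (hL' p (List.mem_cons_self ..)) x hx, Matrix.mulVec_zero]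
    have h1 : (ev 1).mulVec x = x := by rw [map_one, Matrix.one_mulVec]
    rw [← hcert, map_add, map_list_sum, map_sum, Matrix.add_mulVec, hzero L hL, zero_add] at h1
    exact h1
  -- hence `U ≤ range S`
  have hle : U ≤ LinearMap.range (Matrix.toLin' S) := by
    intro x hx
    exact ⟨x, by rw [Matrix.toLin'_apply, hfix x hx]⟩
  calc Module.finrank K U ≤ Module.finrank K (LinearMap.range (Matrix.toLin' S)) := Submodule.finrank_mono hle
    _ = S.rank := rfl
    _ ≤ ∑ ρ, (ev (u ρ * g ρ * v ρ)).rank := rank_sum_le _ _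
    _ ≤ ∑ _ρ : Fin r, t := Finset.sum_le_sum fun ρ _ => by
        rw [map_mul, map_mul]
        exact ((Matrix.rank_mul_le_left _ _).trans (Matrix.rank_mul_le_right _ _)).trans (hax _ (hg ρ))
    _ = r * t := by simp

end Ceiling

end Summit.PneNP.PneNP.Theorems.CnfIdealGenLength
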